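import Mathlib
import HarnessLib
import Literature.LinearAlgebra.Matrix.GeneralizedVandermonde
import Summits.ValiantsHypothesis.ValiantsHypothesis.Theorems.KPlusLogSqLawWeakLiftingTowerGraftWronskianKFourAlternating
import Summits.ValiantsHypothesis.ValiantsHypothesis.Theorems.KPlusLogSqLawWeakLiftingTowerGraftWronskianConjectureWFourReductions

/-!
# Tower graft line — CONJECTURE W AT `K = 4` IS AN ALTERNANT LAW (five zeros force `X·W ∝` the generalized Vandermonde alternant)

Helper file for LINE (B) `Cruxes/WeakLifting/Lines/tower_graft.lean` (crux `WeakLifting` = stmt-ValiantsHypothesis-19561), on the located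
target (W-4) = `ConjectureWAt 4` of `…WronskianConjectureWDefs` («`Z₊(W(u,v)) ≤ 4` for two real `4`-nomials on a common support»; the
`k = 1` developable conjecture of [cite: SedykhShapiro2005] for lacunary moment arcs).  NO stub is claimed; `ConjectureWAt 4` stays OPEN.

THE REDUCTION.  On the orientation `d₀ + d₃ < d₁ + d₂` write `X·W(u,v) = Σ_{t<6} c_t X^{e_t}` on the sorted pair sums
`e = (d₀+d₁, d₀+d₂, d₀+d₃, d₁+d₂, d₁+d₃, d₂+d₃)` (`…KFourAlternating.X_mul_wronskian_four_eq`).  If `W` has five distinct positive zeros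
`r₀ < ⋯ < r₄`, the coefficient vector `c` lies in the kernel of the `6 × 5` generalized Vandermonde matrix `G = [r_m^{e_t}]`; so does the
cofactor vector `a_t = (−1)^t A_t`, `A_t = det [r_m^{e_s}]_{s ≠ t}` (Laplace expansion of `[G_m | G]`, `cofactor_sum_eq_zero`), and
`A_0 ≠ 0` by the positivity of generalized Vandermonde determinants (tree: `Literature.LinearAlgebra.Matrix.GeneralizedVandermonde`,
[cite: FischlerSprangZudilin2019, §5 Lemma 4]); hence `c = λ·a` with `λ ≠ 0` (`coeff_eq_smul_alternant_of_five_le`).  Feeding this into the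
Plücker relation `p₀₁p₂₃ − p₀₂p₁₃ + p₀₃p₁₂ = 0` (`c_t = p·δ`) gives the

* ★★ ALTERNANT IDENTITY `alternant_identity_of_five_le`:  `A₁A₄·w₁w₃ = A₀A₅·w₂w₃ + A₂A₃·w₁w₂`, where
  `w₁ = (d₁−d₀)(d₃−d₂)`, `w₂ = (d₂−d₀)(d₃−d₁)`, `w₃ = (d₃−d₀)(d₂−d₁)` (note `w₂ = w₁ + w₃`) and `A_t > 0` are the six maximal minors of `G`;
* ★★ `conjectureWAt_four_of_alternantLaw`: the ALTERNANT LAW «that identity never holds for `0 < r₀ < ⋯ < r₄`, `d` strictly increasing with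
  `d₀ + d₃ < d₁ + d₂`» implies `ConjectureWAt 4` BY NAME (through `…ConjectureWFourReductions.conjectureWAt_four_of_cellLaw`); the sign
  version `conjectureWAt_four_of_alternantLaw_lt` («`A₁A₄·w₁w₃ < A₀A₅·w₂w₃ + A₂A₃·w₁w₂`») is the form supported by numerics.

So (W-4) is now an explicit inequality between products of generalized Vandermonde determinants on a five-point configuration (the zone
law of hand g11 is no longer needed as an intermediate).  Evidence memo (item evidence on stmt-19561, this hand): in `3.9·10³` random
samples `max LHS/RHS = 0.995`, the near-tight corner being `d₁ ≈ d₂ ≈ d₃` (support shape `(0, n, n+1, n+2)`, `n → ∞`); the NAIVE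
log-concavity `A₂A₃ ≥ A₁A₄` is FALSE there (ratio `→ 1/4` at clustered roots), so the `A₀A₅·w₂w₃` term is load-bearing in any proof.

HONEST FRAMING: a reformulation, not a proof; nothing on S4/S4f/S5/S5ᴸ, TowerB, `WeakLifting`, Conjecture B, `MatrixDescartes` (18050),
`VP ≠ VNP`.  Def-free.  Seat: prover leafhand-val-kpluslogsqlaw-1 g12, `--supports stmt-ValiantsHypothesis-19561 --as helper`.
[folklore: Laplace expansion, Cramer; cite: FischlerSprangZudilin2019 Lemma 4 (tree); the reduction is this work]
-/

-- `Summit.ValiantsHypothesis.ValiantsHypothesis.…` repeats a component by the D-0017 layout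
-- (single-conjunct summit), which the `dupNamespace` linter flags; the name is mandated.
set_option linter.dupNamespace false
set_option autoImplicit false

namespace Summit.ValiantsHypothesis.ValiantsHypothesis.Theorems.KPlusLogSqLaw.TowerGraft

open Polynomial Finset
open scoped BigOperators Polynomial
open Literature.LinearAlgebra.Matrix.GeneralizedVandermonde (genVandermonde genVandermonde_apply det_genVandermonde_pos
  det_genVandermonde_ne_zero)

namespace WronskianDevelopable

/-! ## §1 Linear algebra: the cofactor vector of a `(n+1) × n` matrix is in its left kernel -/

/-- **cofactor vector**: for a `(n+1) × n` real matrix `G` and every column `m`, `Σ_i (−1)^i det(G without row i) · G_{i m} = 0`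
(Laplace expansion of the square matrix `[G_m | G]` along its first column; that matrix has two equal columns). [folklore] -/
theorem cofactor_sum_eq_zero {n : ℕ} (G : Matrix (Fin (n + 1)) (Fin n) ℝ) (m : Fin n) :
    ∑ i : Fin (n + 1), ((-1 : ℝ) ^ (i : ℕ) * (G.submatrix i.succAbove id).det) * G i m = 0 := by
  set M : Matrix (Fin (n + 1)) (Fin (n + 1)) ℝ := Matrix.of fun i => Fin.cons (G i m) (G i) with hM
  have hdet : M.det = 0 := by
    refine Matrix.det_zero_of_column_eq (Fin.succ_ne_zero m).symm (fun k => ?_)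
    simp [hM]
  have hsub : ∀ i : Fin (n + 1), M.submatrix i.succAbove Fin.succ = G.submatrix i.succAbove id := by
    intro i; ext a b; simp [hM]
  have h0 : ∀ i, M i 0 = G i m := fun i => by simp [hM]
  rw [Matrix.det_succ_column_zero] at hdet
  simp only [hsub, h0] at hdet
  calc ∑ i : Fin (n + 1), ((-1 : ℝ) ^ (i : ℕ) * (G.submatrix i.succAbove id).det) * G i m
      = ∑ i : Fin (n + 1), (-1 : ℝ) ^ (i : ℕ) * G i m * (G.submatrix i.succAbove id).det :=
        Finset.sum_congr rfl fun i _ => by ring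
    _ = 0 := hdet

/-- **one-dimensional left kernel**: if the minor `det(G without row 0)` is non-zero, every left-kernel vector of the `(n+1) × n` matrix
`G` is a multiple of the cofactor vector. [folklore: Cramer] -/
theorem eq_smul_cofactor_of_sum_eq_zero {n : ℕ} (G : Matrix (Fin (n + 1)) (Fin n) ℝ)
    (h0 : (G.submatrix (0 : Fin (n + 1)).succAbove id).det ≠ 0) (c : Fin (n + 1) → ℝ)
    (hc : ∀ m, ∑ i : Fin (n + 1), c i * G i m = 0) :
    ∃ lam : ℝ, ∀ i, c i = lam * ((-1 : ℝ) ^ (i : ℕ) * (G.submatrix i.succAbove id).det) := by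
  classical
  set a : Fin (n + 1) → ℝ := fun i => (-1 : ℝ) ^ (i : ℕ) * (G.submatrix i.succAbove id).det with ha
  have ha0 : a 0 = (G.submatrix (0 : Fin (n + 1)).succAbove id).det := by simp [ha]
  have ha0ne : a 0 ≠ 0 := by rw [ha0]; exact h0
  refine ⟨c 0 / a 0, ?_⟩
  -- the difference `b = c − λ a` vanishes at index `0` and is in the left kernel of the square minor
  set lam : ℝ := c 0 / a 0 with hlam
  set b : Fin n → ℝ := fun j => c j.succ - lam * a j.succ with hb
  have hb0 : c 0 - lam * a 0 = 0 := by rw [hlam]; field_simp; ring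
  have hker : Matrix.vecMul b (G.submatrix (0 : Fin (n + 1)).succAbove id) = 0 := by
    funext m
    have h1 : ∑ i : Fin (n + 1), (c i - lam * a i) * G i m = 0 := by
      have e1 : ∑ i : Fin (n + 1), (c i - lam * a i) * G i m =
          ∑ i : Fin (n + 1), c i * G i m - lam * ∑ i : Fin (n + 1), a i * G i m := by
        rw [Finset.mul_sum, ← Finset.sum_sub_distrib]
        exact Finset.sum_congr rfl fun i _ => by ring
      rw [e1, hc m, cofactor_sum_eq_zero G m]; ring
    rw [Fin.sum_univ_succ, hb0, zero_mul, zero_add] at h1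
    simpa [Matrix.vecMul, dotProduct, hb, Fin.succAbove_zero] using h1
  have hbz : b = 0 := by
    by_contra hne
    exact h0 (Matrix.exists_vecMul_eq_zero_iff.mp ⟨b, hne, hker⟩)
  intro i
  refine Fin.cases ?_ (fun j => ?_) i
  · have : c 0 = lam * a 0 := by linarith
    simpa [ha] using this
  · have hj : b j = 0 := by rw [hbz]; rfl
    have : c j.succ = lam * a j.succ := by simp only [hb] at hj; linarith
    simpa [ha] using this

/-! ## §2 Five zeros force the coefficients of `X·W` to be a multiple of the alternant of the zero set -/

/-- evaluation of the six-term form of `X·W(u,v)`. [this work] -/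
theorem eval_X_mul_wronskian_four (u v : Fin 4 → ℝ) (d : Fin 4 → ℕ) (x : ℝ) :
    ((X : ℝ[X]) * wronskian (∑ l, C (u l) * X ^ d l) (∑ l, C (v l) * X ^ d l)).eval x =
      ∑ t : Fin 6, (![(u 0 * v 1 - u 1 * v 0) * ((d 1 : ℝ) - d 0), (u 0 * v 2 - u 2 * v 0) * ((d 2 : ℝ) - d 0),
          (u 0 * v 3 - u 3 * v 0) * ((d 3 : ℝ) - d 0), (u 1 * v 2 - u 2 * v 1) * ((d 2 : ℝ) - d 1),
          (u 1 * v 3 - u 3 * v 1) * ((d 3 : ℝ) - d 1), (u 2 * v 3 - u 3 * v 2) * ((d 3 : ℝ) - d 2)] : Fin 6 → ℝ) t *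
        x ^ (![d 0 + d 1, d 0 + d 2, d 0 + d 3, d 1 + d 2, d 1 + d 3, d 2 + d 3] : Fin 6 → ℕ) t := by
  rw [X_mul_wronskian_four_eq]
  simp only [eval_add, eval_mul, eval_C, eval_pow, eval_X, Fin.sum_univ_six]
  simp

/-- the sorted pair sums are strictly increasing on the orientation `d₀ + d₃ < d₁ + d₂`. [this work] -/
theorem strictMono_pairSums_six (d : Fin 4 → ℕ) (hd : StrictMono d) (hA : d 0 + d 3 < d 1 + d 2) :
    StrictMono (![d 0 + d 1, d 0 + d 2, d 0 + d 3, d 1 + d 2, d 1 + d 3, d 2 + d 3] : Fin 6 → ℕ) := by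
  have h01 : d 0 < d 1 := hd (by decide)
  have h12 : d 1 < d 2 := hd (by decide)
  have h23 : d 2 < d 3 := hd (by decide)
  refine Fin.strictMono_iff_lt_succ.mpr fun i => ?_
  fin_cases i <;> simp <;> omega

/-- ★★ **FIVE ZEROS FORCE `X·W ∝ ALTERNANT`.**  On the orientation `d₀ + d₃ < d₁ + d₂`, if `W(u,v)` has at least five distinct positive
zeros then there are zeros `0 < r₀ < ⋯ < r₄` of `W` and `λ ≠ 0` with `c_t = λ·(−1)^t·det [r_m^{e_s}]_{s ≠ t}` for each of the six sorted
pair-sum coefficients `c_t` of `X·W(u,v)`. [this work; uses FischlerSprangZudilin2019 Lemma 4 from the tree] -/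
theorem coeff_eq_smul_alternant_of_five_le (u v : Fin 4 → ℝ) (d : Fin 4 → ℕ) (hd : StrictMono d) (hA : d 0 + d 3 < d 1 + d 2)
    (h5 : 5 ≤ ((wronskian (∑ l, C (u l) * (X : ℝ[X]) ^ d l) (∑ l, C (v l) * (X : ℝ[X]) ^ d l)).roots.toFinset.filter
      (fun x => 0 < x)).card) :
    ∃ r : Fin 5 → ℝ, StrictMono r ∧ (∀ m, 0 < r m) ∧
      (∀ m, (wronskian (∑ l, C (u l) * (X : ℝ[X]) ^ d l) (∑ l, C (v l) * (X : ℝ[X]) ^ d l)).IsRoot (r m)) ∧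
      ∃ lam : ℝ, lam ≠ 0 ∧ ∀ t : Fin 6,
        (![(u 0 * v 1 - u 1 * v 0) * ((d 1 : ℝ) - d 0), (u 0 * v 2 - u 2 * v 0) * ((d 2 : ℝ) - d 0),
          (u 0 * v 3 - u 3 * v 0) * ((d 3 : ℝ) - d 0), (u 1 * v 2 - u 2 * v 1) * ((d 2 : ℝ) - d 1),
          (u 1 * v 3 - u 3 * v 1) * ((d 3 : ℝ) - d 1), (u 2 * v 3 - u 3 * v 2) * ((d 3 : ℝ) - d 2)] : Fin 6 → ℝ) t =
        lam * ((-1 : ℝ) ^ (t : ℕ) *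
          (genVandermonde r ((![d 0 + d 1, d 0 + d 2, d 0 + d 3, d 1 + d 2, d 1 + d 3, d 2 + d 3] : Fin 6 → ℕ) ∘
            t.succAbove)).det) := by
  classical
  set W : ℝ[X] := wronskian (∑ l, C (u l) * (X : ℝ[X]) ^ d l) (∑ l, C (v l) * (X : ℝ[X]) ^ d l) with hW
  set e : Fin 6 → ℕ := ![d 0 + d 1, d 0 + d 2, d 0 + d 3, d 1 + d 2, d 1 + d 3, d 2 + d 3] with he_def
  set c : Fin 6 → ℝ := ![(u 0 * v 1 - u 1 * v 0) * ((d 1 : ℝ) - d 0), (u 0 * v 2 - u 2 * v 0) * ((d 2 : ℝ) - d 0),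
          (u 0 * v 3 - u 3 * v 0) * ((d 3 : ℝ) - d 0), (u 1 * v 2 - u 2 * v 1) * ((d 2 : ℝ) - d 1),
          (u 1 * v 3 - u 3 * v 1) * ((d 3 : ℝ) - d 1), (u 2 * v 3 - u 3 * v 2) * ((d 3 : ℝ) - d 2)] with hc_def
  have he : StrictMono e := strictMono_pairSums_six d hd hA
  -- `W ≠ 0`
  have hW0 : W ≠ 0 := by
    intro h0
    rw [h0, roots_zero] at h5
    simp at h5
  -- five ordered positive zeros
  obtain ⟨T, hTS, hT⟩ := Finset.exists_subset_card_eq h5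
  set r : Fin 5 → ℝ := fun m => T.orderEmbOfFin hT m with hr_def
  have hr : StrictMono r := fun i j hij => (T.orderEmbOfFin hT).strictMono hij
  have hrT : ∀ m, r m ∈ T := fun m => Finset.orderEmbOfFin_mem T hT m
  have hr0 : ∀ m, 0 < r m := fun m => (Finset.mem_filter.mp (hTS (hrT m))).2
  have hroot : ∀ m, W.IsRoot (r m) := fun m => by
    have h := (Finset.mem_filter.mp (hTS (hrT m))).1
    rw [Multiset.mem_toFinset] at h
    exact (mem_roots hW0).mp h
  -- the generalized Vandermonde matrix `G = [r_m^{e_t}]` (rows = exponents) and the kernel equations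
  set G : Matrix (Fin 6) (Fin 5) ℝ := Matrix.of fun t m => r m ^ e t with hG
  have hcG : ∀ m, ∑ t : Fin 6, c t * G t m = 0 := by
    intro m
    have h1 : ((X : ℝ[X]) * W).eval (r m) = 0 := by rw [eval_mul, (hroot m).eq_zero, mul_zero]
    rw [hW, eval_X_mul_wronskian_four] at h1
    simpa [hG] using h1
  -- the minors are generalized Vandermonde determinants, hence non-zero
  have hsubG : ∀ t : Fin 6, G.submatrix t.succAbove id = genVandermonde r (e ∘ t.succAbove) := by
    intro t; ext a b; simp [hG, genVandermonde_apply]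
  have hmin : ∀ t : Fin 6, (G.submatrix t.succAbove id).det ≠ 0 := by
    intro t
    rw [hsubG t]
    exact det_genVandermonde_ne_zero hr hr0 (he.comp (Fin.strictMono_succAbove t))
  obtain ⟨lam, hlam⟩ := eq_smul_cofactor_of_sum_eq_zero G (hmin 0) c hcG
  -- `λ ≠ 0`, else `X·W = 0`
  have hlam0 : lam ≠ 0 := by
    intro hl
    have hc0 : ∀ t, c t = 0 := fun t => by rw [hlam t, hl, zero_mul]
    have hXW : (X : ℝ[X]) * W = 0 := by
      rw [hW, X_mul_wronskian_four_eq]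
      have e0 := hc0 0; have e1 := hc0 1; have e2 := hc0 2; have e3 := hc0 3; have e4 := hc0 4; have e5 := hc0 5
      simp only [hc_def, Matrix.cons_val_zero, Matrix.cons_val_one] at e0 e1 e2 e3 e4 e5
      simp only [Matrix.cons_val] at e2 e3 e4 e5
      rw [e0, e1, e2, e3, e4, e5]
      simp
    exact hW0 ((mul_eq_zero.mp hXW).resolve_left X_ne_zero)
  refine ⟨r, hr, hr0, hroot, lam, hlam0, fun t => ?_⟩
  rw [← hsubG t]
  exact hlam t

/-! ## §3 The alternant identity and the reduction of Conjecture W at `K = 4` to the alternant law -/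

/-- ★★ **THE ALTERNANT IDENTITY FORCED BY FIVE ZEROS** (orientation `d₀ + d₃ < d₁ + d₂`): with `A_t` the six maximal minors of
`[r_m^{e_s}]` at five zeros `0 < r₀ < ⋯ < r₄` of `W(u,v)` and `w₁ = (d₁−d₀)(d₃−d₂)`, `w₂ = (d₂−d₀)(d₃−d₁)`, `w₃ = (d₃−d₀)(d₂−d₁)`:
`A₁A₄·w₁w₃ = A₀A₅·w₂w₃ + A₂A₃·w₁w₂` (the Plücker relation `p₀₁p₂₃ − p₀₂p₁₃ + p₀₃p₁₂ = 0` in alternant form). [this work] -/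
theorem alternant_identity_of_five_le (u v : Fin 4 → ℝ) (d : Fin 4 → ℕ) (hd : StrictMono d) (hA : d 0 + d 3 < d 1 + d 2)
    (h5 : 5 ≤ ((wronskian (∑ l, C (u l) * (X : ℝ[X]) ^ d l) (∑ l, C (v l) * (X : ℝ[X]) ^ d l)).roots.toFinset.filter
      (fun x => 0 < x)).card) :
    ∃ r : Fin 5 → ℝ, StrictMono r ∧ (∀ m, 0 < r m) ∧
      (∀ m, (wronskian (∑ l, C (u l) * (X : ℝ[X]) ^ d l) (∑ l, C (v l) * (X : ℝ[X]) ^ d l)).IsRoot (r m)) ∧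
      (genVandermonde r ![d 0 + d 1, d 0 + d 3, d 1 + d 2, d 1 + d 3, d 2 + d 3]).det *
          (genVandermonde r ![d 0 + d 1, d 0 + d 2, d 0 + d 3, d 1 + d 2, d 2 + d 3]).det *
          ((((d 1 : ℝ) - d 0) * ((d 3 : ℝ) - d 2)) * (((d 3 : ℝ) - d 0) * ((d 2 : ℝ) - d 1))) =
        (genVandermonde r ![d 0 + d 2, d 0 + d 3, d 1 + d 2, d 1 + d 3, d 2 + d 3]).det *
            (genVandermonde r ![d 0 + d 1, d 0 + d 2, d 0 + d 3, d 1 + d 2, d 1 + d 3]).det *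
            ((((d 2 : ℝ) - d 0) * ((d 3 : ℝ) - d 1)) * (((d 3 : ℝ) - d 0) * ((d 2 : ℝ) - d 1))) +
          (genVandermonde r ![d 0 + d 1, d 0 + d 2, d 1 + d 2, d 1 + d 3, d 2 + d 3]).det *
            (genVandermonde r ![d 0 + d 1, d 0 + d 2, d 0 + d 3, d 1 + d 3, d 2 + d 3]).det *
            ((((d 1 : ℝ) - d 0) * ((d 3 : ℝ) - d 2)) * (((d 2 : ℝ) - d 0) * ((d 3 : ℝ) - d 1))) := by
  obtain ⟨r, hr, hr0, hroot, lam, hlam0, hc⟩ := coeff_eq_smul_alternant_of_five_le u v d hd hA h5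
  refine ⟨r, hr, hr0, hroot, ?_⟩
  -- the six minors, with explicit exponent lists
  have s0 : ((![d 0 + d 1, d 0 + d 2, d 0 + d 3, d 1 + d 2, d 1 + d 3, d 2 + d 3] : Fin 6 → ℕ) ∘ (0 : Fin 6).succAbove) =
      ![d 0 + d 2, d 0 + d 3, d 1 + d 2, d 1 + d 3, d 2 + d 3] := by
    funext j; fin_cases j <;> rfl
  have s1 : ((![d 0 + d 1, d 0 + d 2, d 0 + d 3, d 1 + d 2, d 1 + d 3, d 2 + d 3] : Fin 6 → ℕ) ∘ (1 : Fin 6).succAbove) =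
      ![d 0 + d 1, d 0 + d 3, d 1 + d 2, d 1 + d 3, d 2 + d 3] := by
    funext j; fin_cases j <;> rfl
  have s2 : ((![d 0 + d 1, d 0 + d 2, d 0 + d 3, d 1 + d 2, d 1 + d 3, d 2 + d 3] : Fin 6 → ℕ) ∘ (2 : Fin 6).succAbove) =
      ![d 0 + d 1, d 0 + d 2, d 1 + d 2, d 1 + d 3, d 2 + d 3] := by
    funext j; fin_cases j <;> rfl
  have s3 : ((![d 0 + d 1, d 0 + d 2, d 0 + d 3, d 1 + d 2, d 1 + d 3, d 2 + d 3] : Fin 6 → ℕ) ∘ (3 : Fin 6).succAbove) =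
      ![d 0 + d 1, d 0 + d 2, d 0 + d 3, d 1 + d 3, d 2 + d 3] := by
    funext j; fin_cases j <;> rfl
  have s4 : ((![d 0 + d 1, d 0 + d 2, d 0 + d 3, d 1 + d 2, d 1 + d 3, d 2 + d 3] : Fin 6 → ℕ) ∘ (4 : Fin 6).succAbove) =
      ![d 0 + d 1, d 0 + d 2, d 0 + d 3, d 1 + d 2, d 2 + d 3] := by
    funext j; fin_cases j <;> rfl
  have s5 : ((![d 0 + d 1, d 0 + d 2, d 0 + d 3, d 1 + d 2, d 1 + d 3, d 2 + d 3] : Fin 6 → ℕ) ∘ (5 : Fin 6).succAbove) =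
      ![d 0 + d 1, d 0 + d 2, d 0 + d 3, d 1 + d 2, d 1 + d 3] := by
    funext j; fin_cases j <;> rfl
  have c0 := hc 0; have c1 := hc 1; have c2 := hc 2; have c3 := hc 3; have c4 := hc 4; have c5 := hc 5
  rw [s0] at c0; rw [s1] at c1; rw [s2] at c2; rw [s3] at c3; rw [s4] at c4; rw [s5] at c5
  simp only [Matrix.cons_val_zero, Matrix.cons_val_one, Matrix.cons_val, Fin.val_zero, Fin.val_one,
    pow_zero, pow_one, one_mul] at c0 c1 c2 c3 c4 c5
  norm_num at c0 c1 c2 c3 c4 c5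
  -- abbreviate the minors
  set A0 := (genVandermonde r ![d 0 + d 2, d 0 + d 3, d 1 + d 2, d 1 + d 3, d 2 + d 3]).det
  set A1 := (genVandermonde r ![d 0 + d 1, d 0 + d 3, d 1 + d 2, d 1 + d 3, d 2 + d 3]).det
  set A2 := (genVandermonde r ![d 0 + d 1, d 0 + d 2, d 1 + d 2, d 1 + d 3, d 2 + d 3]).det
  set A3 := (genVandermonde r ![d 0 + d 1, d 0 + d 2, d 0 + d 3, d 1 + d 3, d 2 + d 3]).det
  set A4 := (genVandermonde r ![d 0 + d 1, d 0 + d 2, d 0 + d 3, d 1 + d 2, d 2 + d 3]).det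
  set A5 := (genVandermonde r ![d 0 + d 1, d 0 + d 2, d 0 + d 3, d 1 + d 2, d 1 + d 3]).det
  -- the Plücker relation, multiplied through by `w₁w₂w₃`
  have hpl : ((u 0 * v 2 - u 2 * v 0) * ((d 2 : ℝ) - d 0)) * ((u 1 * v 3 - u 3 * v 1) * ((d 3 : ℝ) - d 1)) *
        ((((d 1 : ℝ) - d 0) * ((d 3 : ℝ) - d 2)) * (((d 3 : ℝ) - d 0) * ((d 2 : ℝ) - d 1))) =
      ((u 0 * v 1 - u 1 * v 0) * ((d 1 : ℝ) - d 0)) * ((u 2 * v 3 - u 3 * v 2) * ((d 3 : ℝ) - d 2)) *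
          ((((d 2 : ℝ) - d 0) * ((d 3 : ℝ) - d 1)) * (((d 3 : ℝ) - d 0) * ((d 2 : ℝ) - d 1))) +
        ((u 0 * v 3 - u 3 * v 0) * ((d 3 : ℝ) - d 0)) * ((u 1 * v 2 - u 2 * v 1) * ((d 2 : ℝ) - d 1)) *
          ((((d 1 : ℝ) - d 0) * ((d 3 : ℝ) - d 2)) * (((d 2 : ℝ) - d 0) * ((d 3 : ℝ) - d 1))) := by
    ring
  rw [c0, c1, c2, c3, c4, c5] at hpl
  have hl2 : lam ^ 2 ≠ 0 := pow_ne_zero 2 hlam0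
  have key : lam ^ 2 * (A1 * A4 * ((((d 1 : ℝ) - d 0) * ((d 3 : ℝ) - d 2)) * (((d 3 : ℝ) - d 0) * ((d 2 : ℝ) - d 1)))) =
      lam ^ 2 * (A0 * A5 * ((((d 2 : ℝ) - d 0) * ((d 3 : ℝ) - d 1)) * (((d 3 : ℝ) - d 0) * ((d 2 : ℝ) - d 1))) +
        A2 * A3 * ((((d 1 : ℝ) - d 0) * ((d 3 : ℝ) - d 2)) * (((d 2 : ℝ) - d 0) * ((d 3 : ℝ) - d 1)))) := by
    linear_combination (-1 : ℝ) * hpl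
  exact mul_left_cancel₀ hl2 key

/-- positivity of the six minors (generalized Vandermonde determinants at five ordered positive points, strictly increasing exponents).
[cite: FischlerSprangZudilin2019, §5 Lemma 4 (tree `Literature.LinearAlgebra.Matrix.GeneralizedVandermonde.det_genVandermonde_pos`)] -/
theorem alternant_minors_pos (r : Fin 5 → ℝ) (hr : StrictMono r) (hr0 : ∀ m, 0 < r m) (d : Fin 4 → ℕ) (hd : StrictMono d)
    (hA : d 0 + d 3 < d 1 + d 2) :
    0 < (genVandermonde r ![d 0 + d 2, d 0 + d 3, d 1 + d 2, d 1 + d 3, d 2 + d 3]).det ∧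
      0 < (genVandermonde r ![d 0 + d 1, d 0 + d 3, d 1 + d 2, d 1 + d 3, d 2 + d 3]).det ∧
      0 < (genVandermonde r ![d 0 + d 1, d 0 + d 2, d 1 + d 2, d 1 + d 3, d 2 + d 3]).det ∧
      0 < (genVandermonde r ![d 0 + d 1, d 0 + d 2, d 0 + d 3, d 1 + d 3, d 2 + d 3]).det ∧
      0 < (genVandermonde r ![d 0 + d 1, d 0 + d 2, d 0 + d 3, d 1 + d 2, d 2 + d 3]).det ∧
      0 < (genVandermonde r ![d 0 + d 1, d 0 + d 2, d 0 + d 3, d 1 + d 2, d 1 + d 3]).det := by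
  have h01 : d 0 < d 1 := hd (by decide)
  have h12 : d 1 < d 2 := hd (by decide)
  have h23 : d 2 < d 3 := hd (by decide)
  have sm : ∀ f : Fin 5 → ℕ, (∀ i : Fin 4, f i.castSucc < f i.succ) → StrictMono f := fun f hf =>
    Fin.strictMono_iff_lt_succ.mpr hf
  refine ⟨det_genVandermonde_pos 5 r _ hr hr0 (sm _ fun i => ?_), det_genVandermonde_pos 5 r _ hr hr0 (sm _ fun i => ?_),
    det_genVandermonde_pos 5 r _ hr hr0 (sm _ fun i => ?_), det_genVandermonde_pos 5 r _ hr hr0 (sm _ fun i => ?_),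
    det_genVandermonde_pos 5 r _ hr hr0 (sm _ fun i => ?_), det_genVandermonde_pos 5 r _ hr hr0 (sm _ fun i => ?_)⟩ <;>
  fin_cases i <;> simp <;> omega

/-- ★★ **ALTERNANT LAW ⇒ `Z₊(W) ≤ 4` on the orientation `d₀ + d₃ < d₁ + d₂`.** [this work] -/
theorem card_posRoots_wronskian_four_le_four_of_alternantLaw_orient
    (AL : ∀ (r : Fin 5 → ℝ), StrictMono r → (∀ m, 0 < r m) → ∀ (d : Fin 4 → ℕ), StrictMono d → d 0 + d 3 < d 1 + d 2 →
      (genVandermonde r ![d 0 + d 1, d 0 + d 3, d 1 + d 2, d 1 + d 3, d 2 + d 3]).det *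
          (genVandermonde r ![d 0 + d 1, d 0 + d 2, d 0 + d 3, d 1 + d 2, d 2 + d 3]).det *
          ((((d 1 : ℝ) - d 0) * ((d 3 : ℝ) - d 2)) * (((d 3 : ℝ) - d 0) * ((d 2 : ℝ) - d 1))) ≠
        (genVandermonde r ![d 0 + d 2, d 0 + d 3, d 1 + d 2, d 1 + d 3, d 2 + d 3]).det *
            (genVandermonde r ![d 0 + d 1, d 0 + d 2, d 0 + d 3, d 1 + d 2, d 1 + d 3]).det *
            ((((d 2 : ℝ) - d 0) * ((d 3 : ℝ) - d 1)) * (((d 3 : ℝ) - d 0) * ((d 2 : ℝ) - d 1))) +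
          (genVandermonde r ![d 0 + d 1, d 0 + d 2, d 1 + d 2, d 1 + d 3, d 2 + d 3]).det *
            (genVandermonde r ![d 0 + d 1, d 0 + d 2, d 0 + d 3, d 1 + d 3, d 2 + d 3]).det *
            ((((d 1 : ℝ) - d 0) * ((d 3 : ℝ) - d 2)) * (((d 2 : ℝ) - d 0) * ((d 3 : ℝ) - d 1))))
    (u v : Fin 4 → ℝ) (d : Fin 4 → ℕ) (hd : StrictMono d) (hA : d 0 + d 3 < d 1 + d 2) :
    ((wronskian (∑ l, C (u l) * (X : ℝ[X]) ^ d l) (∑ l, C (v l) * (X : ℝ[X]) ^ d l)).roots.toFinset.filter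
      (fun x => 0 < x)).card ≤ 4 := by
  by_contra hgt
  have h5 : 5 ≤ ((wronskian (∑ l, C (u l) * (X : ℝ[X]) ^ d l) (∑ l, C (v l) * (X : ℝ[X]) ^ d l)).roots.toFinset.filter
      (fun x => 0 < x)).card := by omega
  obtain ⟨r, hr, hr0, -, hid⟩ := alternant_identity_of_five_le u v d hd hA h5
  exact AL r hr hr0 d hd hA hid

/-- ★★ **CONJECTURE W AT `K = 4` FOLLOWS FROM THE ALTERNANT LAW** (by name, all supports: the cell reduction of hands g10–g11 handles the
other orientation and the balanced case). [this work] -/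
theorem conjectureWAt_four_of_alternantLaw
    (AL : ∀ (r : Fin 5 → ℝ), StrictMono r → (∀ m, 0 < r m) → ∀ (d : Fin 4 → ℕ), StrictMono d → d 0 + d 3 < d 1 + d 2 →
      (genVandermonde r ![d 0 + d 1, d 0 + d 3, d 1 + d 2, d 1 + d 3, d 2 + d 3]).det *
          (genVandermonde r ![d 0 + d 1, d 0 + d 2, d 0 + d 3, d 1 + d 2, d 2 + d 3]).det *
          ((((d 1 : ℝ) - d 0) * ((d 3 : ℝ) - d 2)) * (((d 3 : ℝ) - d 0) * ((d 2 : ℝ) - d 1))) ≠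
        (genVandermonde r ![d 0 + d 2, d 0 + d 3, d 1 + d 2, d 1 + d 3, d 2 + d 3]).det *
            (genVandermonde r ![d 0 + d 1, d 0 + d 2, d 0 + d 3, d 1 + d 2, d 1 + d 3]).det *
            ((((d 2 : ℝ) - d 0) * ((d 3 : ℝ) - d 1)) * (((d 3 : ℝ) - d 0) * ((d 2 : ℝ) - d 1))) +
          (genVandermonde r ![d 0 + d 1, d 0 + d 2, d 1 + d 2, d 1 + d 3, d 2 + d 3]).det *
            (genVandermonde r ![d 0 + d 1, d 0 + d 2, d 0 + d 3, d 1 + d 3, d 2 + d 3]).det *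
            ((((d 1 : ℝ) - d 0) * ((d 3 : ℝ) - d 2)) * (((d 2 : ℝ) - d 0) * ((d 3 : ℝ) - d 1)))) :
    ConjectureWAt 4 :=
  conjectureWAt_four_of_cellLaw fun u v d hd hA _ _ _ _ _ =>
    card_posRoots_wronskian_four_le_four_of_alternantLaw_orient AL u v d hd hA

/-- ★★ **sign form**: the ALTERNANT LAW «`A₁A₄·w₁w₃ < A₀A₅·w₂w₃ + A₂A₃·w₁w₂`» (the inequality observed numerically; all six minors are
positive by `alternant_minors_pos`) implies Conjecture W at `K = 4`. [this work] -/
theorem conjectureWAt_four_of_alternantLaw_lt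
    (AL : ∀ (r : Fin 5 → ℝ), StrictMono r → (∀ m, 0 < r m) → ∀ (d : Fin 4 → ℕ), StrictMono d → d 0 + d 3 < d 1 + d 2 →
      (genVandermonde r ![d 0 + d 1, d 0 + d 3, d 1 + d 2, d 1 + d 3, d 2 + d 3]).det *
          (genVandermonde r ![d 0 + d 1, d 0 + d 2, d 0 + d 3, d 1 + d 2, d 2 + d 3]).det *
          ((((d 1 : ℝ) - d 0) * ((d 3 : ℝ) - d 2)) * (((d 3 : ℝ) - d 0) * ((d 2 : ℝ) - d 1))) <
        (genVandermonde r ![d 0 + d 2, d 0 + d 3, d 1 + d 2, d 1 + d 3, d 2 + d 3]).det *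
            (genVandermonde r ![d 0 + d 1, d 0 + d 2, d 0 + d 3, d 1 + d 2, d 1 + d 3]).det *
            ((((d 2 : ℝ) - d 0) * ((d 3 : ℝ) - d 1)) * (((d 3 : ℝ) - d 0) * ((d 2 : ℝ) - d 1))) +
          (genVandermonde r ![d 0 + d 1, d 0 + d 2, d 1 + d 2, d 1 + d 3, d 2 + d 3]).det *
            (genVandermonde r ![d 0 + d 1, d 0 + d 2, d 0 + d 3, d 1 + d 3, d 2 + d 3]).det *
            ((((d 1 : ℝ) - d 0) * ((d 3 : ℝ) - d 2)) * (((d 2 : ℝ) - d 0) * ((d 3 : ℝ) - d 1)))) :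
    ConjectureWAt 4 :=
  conjectureWAt_four_of_alternantLaw fun r hr hr0 d hd hA => (AL r hr hr0 d hd hA).ne

end WronskianDevelopable

end Summit.ValiantsHypothesis.ValiantsHypothesis.Theorems.KPlusLogSqLaw.TowerGraft
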